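import Literature.NumberTheory.DiophantineGeometry.GenEllConjugateCompactness
import HarnessLib

/-!
# [GenEll] Thm. 2.1, proof, Step "(ii) ⟹ (i)": the finite-subcover step in AVOIDANCE FORM

S. Mochizuki, *Arithmetic elliptic curves in general position*, Math. J. Okayama Univ. 52 (2010),
proof of Theorem 2.1, pp. 12–13 (kurims manuscript): a noncritical Belyi map `φ` adapted to a limit
configuration `Ξ` is one with `φ(Ξ) ⊆ U_P`, i.e. `Ξ` AVOIDS the finite set `E_φ = φ⁻¹({0,1,∞})`; the
points all of whose conjugates stay `r`-far from `E_φ` are then mapped into one compactly bounded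
subset, where statement (ii) applies. [cite: MochizukiGenEll2010, Thm 2.1 proof p.12]

This file specialises the finite-subcover theorem of `GenEllConjugateCompactness`
(`vojtaIneq_univ_of_monotone_cover`) to mechanisms given by FINITE BAD SETS: mechanism `k` carries
finite sets `Xarc k ⊆ ℂ` and `Xnon k ⊆ Q̄_p` (in the application: the `x`-coordinates of `E_φ` for the
`k`-th map, at `∞` and at `p`), and applies with margin `r` to a point `P = (F, x)` when every
complex conjugate `σ x` is `r`-far from `Xarc k` and every `Q̄_p`-conjugate is `r`-far from `Xnon k`.

* `vojtaIneq_univ_of_avoidance`: if every such mechanism-with-margin carries the Vojta inequality in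
  degree `≤ d` (for the one target `ε`), and every configuration of `d` points of `ℂ ∪ {∞}` and `d`
  points of `Q̄_p ∪ {∞}` AVOIDS (exactly, margin `0`) the bad sets of some mechanism, then the Vojta
  inequality holds on all of `U_P(Q̄)^{≤d}` (`VojtaIneq Set.univ d ε`). The margins, the openness and
  the neighbourhoods of `∞` required by the cover theorem are discharged here once and for all.
* `vojtaIneq_univ_of_pairwiseDisjoint`: the pigeonhole instance — finitely many mechanisms with
  PAIRWISE DISJOINT bad sets at each place, more than `2d` of them, avoid every configuration.

Classical point-set topology (Mathlib), PROVED; theorems only; nothing here bears on anything disputed.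
-/

noncomputable section

open NumberField Set OnePoint

namespace Literature.NumberTheory.DiophantineGeometry.GenEll

/-! ## Margins around a finite set -/

/-- In a normed group, the set of points at distance `> (n+1)⁻¹` from every element of a finite set
`X` is open. [cite: MochizukiGenEll2010, Thm 2.1 proof p.12] -/
theorem isOpen_setOf_forall_inv_lt_norm_sub {E : Type*} [SeminormedAddCommGroup E] (X : Finset E)
    (n : ℕ) : IsOpen {z : E | ∀ a ∈ X, ((n : ℝ) + 1)⁻¹ < ‖z - a‖} := by
  have : {z : E | ∀ a ∈ X, ((n : ℝ) + 1)⁻¹ < ‖z - a‖} =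
      ⋂ a ∈ X, {z | ((n : ℝ) + 1)⁻¹ < ‖z - a‖} := by
    ext z; simp
  rw [this]
  exact isOpen_biInter_finset fun a _ =>
    isOpen_lt continuous_const (continuous_id.sub continuous_const).norm

/-- The margin sets grow as the margin `(n+1)⁻¹` shrinks. [cite: MochizukiGenEll2010, Thm 2.1 proof p.12] -/
theorem setOf_forall_inv_lt_norm_sub_mono {E : Type*} [SeminormedAddCommGroup E] (X : Finset E)
    (n : ℕ) : {z : E | ∀ a ∈ X, ((n : ℝ) + 1)⁻¹ < ‖z - a‖} ⊆
      {z : E | ∀ a ∈ X, (((n + 1 : ℕ) : ℝ) + 1)⁻¹ < ‖z - a‖} := by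
  intro z hz a ha
  have h1 : (((n + 1 : ℕ) : ℝ) + 1)⁻¹ ≤ ((n : ℝ) + 1)⁻¹ := by
    apply inv_anti₀ (by positivity)
    push_cast; linarith
  exact lt_of_le_of_lt h1 (hz a ha)

/-- Far from the origin, a point is `(n+1)⁻¹`-far from every element of a fixed finite set: the
margin sets contain a punctured neighbourhood of `∞`. [cite: MochizukiGenEll2010, Thm 2.1 proof p.12] -/
theorem exists_forall_inv_lt_norm_sub_of_lt_norm {E : Type*} [SeminormedAddCommGroup E]
    (X : Finset E) (n : ℕ) : ∃ R : ℝ, ∀ z : E, R < ‖z‖ →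
      z ∈ {z : E | ∀ a ∈ X, ((n : ℝ) + 1)⁻¹ < ‖z - a‖} := by
  refine ⟨(∑ a ∈ X, ‖a‖) + 1, fun z hz a ha => ?_⟩
  have hle : ‖a‖ ≤ ∑ a ∈ X, ‖a‖ :=
    Finset.single_le_sum (f := fun a => ‖a‖) (fun _ _ => norm_nonneg _) ha
  have h1 : ((n : ℝ) + 1)⁻¹ ≤ 1 := by
    apply inv_le_one_of_one_le₀
    have : (0 : ℝ) ≤ n := Nat.cast_nonneg n
    linarith
  have h2 : 1 < ‖z - a‖ := by
    have := norm_sub_norm_le z a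
    linarith
  exact lt_of_le_of_lt h1 h2

/-- A point different from every element of a finite set is `(n+1)⁻¹`-far from all of them for some
`n` (the exact, margin-`0`, avoidance produces a positive margin). [cite: MochizukiGenEll2010, Thm 2.1 proof p.12] -/
theorem exists_forall_inv_lt_norm_sub_of_forall_ne {E : Type*} [NormedAddCommGroup E]
    (X : Finset E) {z : E} (hz : ∀ a ∈ X, z ≠ a) :
    ∃ n : ℕ, ∀ a ∈ X, ((n : ℝ) + 1)⁻¹ < ‖z - a‖ := by
  classical
  induction X using Finset.induction_on with
  | empty => exact ⟨0, fun a ha => absurd ha (Finset.notMem_empty a)⟩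
  | insert b s hb ih =>
    obtain ⟨N, hN⟩ := ih fun a ha => hz a (Finset.mem_insert_of_mem ha)
    have hzb : 0 < ‖z - b‖ := norm_sub_pos_iff.mpr (hz b (Finset.mem_insert_self b s))
    obtain ⟨m, hm⟩ := exists_nat_one_div_lt hzb
    refine ⟨max N m, fun a ha => ?_⟩
    rcases Finset.mem_insert.mp ha with rfl | ha
    · calc (((max N m : ℕ) : ℝ) + 1)⁻¹ ≤ ((m : ℝ) + 1)⁻¹ := by
            apply inv_anti₀ (by positivity)
            have : (m : ℝ) ≤ ((max N m : ℕ) : ℝ) := by exact_mod_cast le_max_right N m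
            linarith
        _ = 1 / ((m : ℝ) + 1) := (one_div _).symm
        _ < ‖z - a‖ := hm
    · calc (((max N m : ℕ) : ℝ) + 1)⁻¹ ≤ ((N : ℝ) + 1)⁻¹ := by
            apply inv_anti₀ (by positivity)
            have : (N : ℝ) ≤ ((max N m : ℕ) : ℝ) := by exact_mod_cast le_max_left N m
            linarith
        _ < ‖z - a‖ := hN a ha

/-! ## The finite-subcover step in avoidance form -/

/-- **Vojta in degree `≤ d` from mechanisms with finite bad sets (avoidance form of the compactness
step).** Fix a prime `p`, a degree `d`, the target `ε`, and mechanisms `k : κ` with finite bad sets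
`Xarc k ⊆ ℂ`, `Xnon k ⊆ Q̄_p`. Suppose (a) for every `k` and every margin `r > 0` the Vojta inequality
`ht ≲ (1+ε)(log-diff + log-cond)` holds in degree `≤ d` on the points ALL of whose complex conjugates
are `r`-far from `Xarc k` and all of whose `Q̄_p`-conjugates are `r`-far from `Xnon k`; and (b) every
configuration of `d` points of `ℂ ∪ {∞}` and `d` points of `Q̄_p ∪ {∞}` avoids the bad sets of SOME
mechanism. Then the Vojta inequality holds on all of `U_P(Q̄)^{≤ d}`. (Compactness of conjugate
configurations, `vojtaIneq_univ_of_monotone_cover`, with margins `(n+1)⁻¹`.)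
[cite: MochizukiGenEll2010, Thm 2.1 proof p.12] -/
theorem vojtaIneq_univ_of_avoidance (p : ℕ) [Fact p.Prime] (d : ℕ) {ε : ℝ} {κ : Type*}
    (Xarc : κ → Finset ℂ) (Xnon : κ → Finset (PadicAlgCl p))
    (hV : ∀ k (r : ℝ), 0 < r → VojtaIneq {P : NFPoint |
        (∀ σ : P.F →+* ℂ, ∀ a ∈ Xarc k, r < ‖σ P.x - a‖) ∧
        (∀ σ : P.F →+* PadicAlgCl p, ∀ a ∈ Xnon k, r < ‖σ P.x - a‖)} d ε)
    (havoid : ∀ (a : Fin d → OnePoint ℂ) (b : Fin d → OnePoint (PadicAlgCl p)), ∃ k : κ,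
        (∀ j, ∀ z ∈ Xarc k, a j ≠ ↑z) ∧ (∀ j, ∀ z ∈ Xnon k, b j ≠ ↑z)) :
    VojtaIneq Set.univ d ε := by
  refine vojtaIneq_univ_of_monotone_cover p d
    (fun k n => {z : ℂ | ∀ a ∈ Xarc k, ((n : ℝ) + 1)⁻¹ < ‖z - a‖})
    (fun k n => isOpen_setOf_forall_inv_lt_norm_sub (Xarc k) n)
    (fun k n => {z : PadicAlgCl p | ∀ a ∈ Xnon k, ((n : ℝ) + 1)⁻¹ < ‖z - a‖})
    (fun k n => isOpen_setOf_forall_inv_lt_norm_sub (Xnon k) n)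
    Set.univ Set.univ
    (fun k _ n => exists_forall_inv_lt_norm_sub_of_lt_norm (Xarc k) n)
    (fun k _ n => exists_forall_inv_lt_norm_sub_of_lt_norm (Xnon k) n)
    (fun k n => setOf_forall_inv_lt_norm_sub_mono (Xarc k) n)
    (fun k n => setOf_forall_inv_lt_norm_sub_mono (Xnon k) n)
    ?_ ?_
  · -- exact avoidance of a configuration produces the qualitative cover
    intro a b
    obtain ⟨k, ha, hb⟩ := havoid a b
    refine ⟨k, fun j => ?_, fun j => ?_⟩
    · induction hj : a j using OnePoint.rec with
      | infty => exact Or.inr ⟨rfl, Set.mem_univ k⟩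
      | coe z =>
        have hz : ∀ w ∈ Xarc k, z ≠ w := fun w hw hzw => ha j w hw (by rw [hj, hzw])
        obtain ⟨n, hn⟩ := exists_forall_inv_lt_norm_sub_of_forall_ne (Xarc k) hz
        exact Or.inl ⟨n, z, hn, rfl⟩
    · induction hj : b j using OnePoint.rec with
      | infty => exact Or.inr ⟨rfl, Set.mem_univ k⟩
      | coe z =>
        have hz : ∀ w ∈ Xnon k, z ≠ w := fun w hw hzw => hb j w hw (by rw [hj, hzw])
        obtain ⟨n, hn⟩ := exists_forall_inv_lt_norm_sub_of_forall_ne (Xnon k) hz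
        exact Or.inl ⟨n, z, hn, rfl⟩
  · -- the Vojta inequality on each margin set
    intro k n
    exact hV k (((n : ℝ) + 1)⁻¹) (by positivity)

/-! ## The pigeonhole instance: pairwise disjoint bad sets -/

/-- **Pigeonhole.** If finitely many mechanisms have PAIRWISE DISJOINT bad sets at `∞` and pairwise
disjoint bad sets at `p`, and there are more than `2d` of them, then every configuration of `d` points
of `ℂ ∪ {∞}` and `d` points of `Q̄_p ∪ {∞}` avoids the bad sets of one of them: each of the `2d` entries
meets the bad sets of at most one mechanism. [cite: MochizukiGenEll2010, Thm 2.1 proof p.12] -/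
theorem exists_avoid_of_pairwiseDisjoint (p : ℕ) [Fact p.Prime] (d : ℕ) {κ : Type*} [Fintype κ]
    (Xarc : κ → Finset ℂ) (Xnon : κ → Finset (PadicAlgCl p))
    (hdisjArc : Pairwise fun i j => Disjoint (Xarc i) (Xarc j))
    (hdisjNon : Pairwise fun i j => Disjoint (Xnon i) (Xnon j))
    (hcard : 2 * d < Fintype.card κ)
    (a : Fin d → OnePoint ℂ) (b : Fin d → OnePoint (PadicAlgCl p)) :
    ∃ k : κ, (∀ j, ∀ z ∈ Xarc k, a j ≠ ↑z) ∧ (∀ j, ∀ z ∈ Xnon k, b j ≠ ↑z) := by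
  classical
  have hκ : Nonempty κ := Fintype.card_pos_iff.mp (lt_of_le_of_lt (Nat.zero_le _) hcard)
  obtain ⟨k₀⟩ := hκ
  -- the (at most one) mechanism whose bad set contains the `j`-th entry
  let gA : Fin d → κ := fun j =>
    if h : ∃ k, ∃ z ∈ Xarc k, a j = ↑z then h.choose else k₀
  let gB : Fin d → κ := fun j =>
    if h : ∃ k, ∃ z ∈ Xnon k, b j = ↑z then h.choose else k₀
  let bad : Finset κ := Finset.univ.image gA ∪ Finset.univ.image gB
  have hbad : bad.card ≤ 2 * d := by
    calc bad.card ≤ (Finset.univ.image gA).card + (Finset.univ.image gB).card :=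
          Finset.card_union_le _ _
      _ ≤ (Finset.univ : Finset (Fin d)).card + (Finset.univ : Finset (Fin d)).card :=
          add_le_add Finset.card_image_le Finset.card_image_le
      _ = 2 * d := by rw [Finset.card_univ, Fintype.card_fin]; ring
  have hlt : bad.card < (Finset.univ : Finset κ).card := by
    rw [Finset.card_univ]; exact lt_of_le_of_lt hbad hcard
  obtain ⟨k, -, hk⟩ := Finset.exists_mem_notMem_of_card_lt_card hlt
  refine ⟨k, fun j z hz hjz => hk ?_, fun j z hz hjz => hk ?_⟩
  · -- `k` would be `gA j`
    have hex : ∃ k, ∃ z ∈ Xarc k, a j = ↑z := ⟨k, z, hz, hjz⟩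
    obtain ⟨z', hz', hjz'⟩ := hex.choose_spec
    have hzz' : z = z' := OnePoint.coe_injective (hjz.symm.trans hjz')
    have hkk : k = hex.choose := by
      by_contra hne
      have hdis := hdisjArc hne
      rw [hzz'] at hz
      exact Finset.disjoint_left.mp hdis hz hz'
    have hgA : gA j = hex.choose := by simp only [gA, dif_pos hex]
    apply Finset.mem_union_left
    rw [Finset.mem_image]
    exact ⟨j, Finset.mem_univ j, by rw [hgA, ← hkk]⟩
  · have hex : ∃ k, ∃ z ∈ Xnon k, b j = ↑z := ⟨k, z, hz, hjz⟩
    obtain ⟨z', hz', hjz'⟩ := hex.choose_spec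
    have hzz' : z = z' := OnePoint.coe_injective (hjz.symm.trans hjz')
    have hkk : k = hex.choose := by
      by_contra hne
      have hdis := hdisjNon hne
      rw [hzz'] at hz
      exact Finset.disjoint_left.mp hdis hz hz'
    have hgB : gB j = hex.choose := by simp only [gB, dif_pos hex]
    apply Finset.mem_union_right
    rw [Finset.mem_image]
    exact ⟨j, Finset.mem_univ j, by rw [hgB, ← hkk]⟩

/-- **Vojta in degree `≤ d` from more than `2d` mechanisms with pairwise disjoint finite bad sets**
(the pigeonhole instance of `vojtaIneq_univ_of_avoidance`): if each mechanism-with-margin carries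
the Vojta inequality in degree `≤ d` for the target `ε`, then `VojtaIneq Set.univ d ε`. This is the
shape in which a finite family of noncritical Belyi maps with pairwise disjoint exceptional fibres on
one curve closes the step "(ii) ⟹ (i)" of [GenEll] Thm. 2.1 without any limit extraction.
[cite: MochizukiGenEll2010, Thm 2.1 proof p.12] -/
theorem vojtaIneq_univ_of_pairwiseDisjoint (p : ℕ) [Fact p.Prime] (d : ℕ) {ε : ℝ} {κ : Type*}
    [Fintype κ] (Xarc : κ → Finset ℂ) (Xnon : κ → Finset (PadicAlgCl p))
    (hdisjArc : Pairwise fun i j => Disjoint (Xarc i) (Xarc j))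
    (hdisjNon : Pairwise fun i j => Disjoint (Xnon i) (Xnon j))
    (hcard : 2 * d < Fintype.card κ)
    (hV : ∀ k (r : ℝ), 0 < r → VojtaIneq {P : NFPoint |
        (∀ σ : P.F →+* ℂ, ∀ a ∈ Xarc k, r < ‖σ P.x - a‖) ∧
        (∀ σ : P.F →+* PadicAlgCl p, ∀ a ∈ Xnon k, r < ‖σ P.x - a‖)} d ε) :
    VojtaIneq Set.univ d ε :=
  vojtaIneq_univ_of_avoidance p d Xarc Xnon hV
    (exists_avoid_of_pairwiseDisjoint p d Xarc Xnon hdisjArc hdisjNon hcard)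

/-! ## The algebraic instance: bad sets cut out by pairwise coprime rational polynomials

In the application the bad set of the `k`-th map is a finite GALOIS-STABLE set of algebraic numbers
(the `x`-coordinates of `E_{φ_k}` for a map `φ_k` defined over `ℚ`), i.e. the set of roots of a
rational polynomial `g k ∈ ℚ[X]`, read in `ℂ` and in `Q̄_p`; disjointness of the bad sets of two maps
at BOTH places follows from coprimality of `g k`, `g k'` in `ℚ[X]`. -/

/-- Coprime polynomials have no common root in any field extension: the finite sets of roots of
`g` and `h` in `K` are disjoint. [cite: MochizukiGenEll2010, Thm 2.1 proof p.12] -/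
theorem disjoint_aroots_toFinset_of_isCoprime {K : Type*} [Field K] [Algebra ℚ K]
    [DecidableEq K] {g h : Polynomial ℚ} (hc : IsCoprime g h) :
    Disjoint (g.aroots K).toFinset (h.aroots K).toFinset := by
  rw [Finset.disjoint_left]
  intro a hag hah
  rw [Multiset.mem_toFinset, Polynomial.mem_aroots] at hag hah
  obtain ⟨u, v, huv⟩ := hc
  have h1 : Polynomial.aeval a (u * g + v * h) = 1 := by rw [huv, map_one]
  rw [map_add, map_mul, map_mul, hag.2, hah.2, mul_zero, mul_zero, add_zero] at h1
  exact zero_ne_one h1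

/-- **Vojta in degree `≤ d` from more than `2d` mechanisms whose bad sets are the roots of pairwise
coprime rational polynomials** (the algebraic form of `vojtaIneq_univ_of_pairwiseDisjoint`): for
`g k ∈ ℚ[X]` pairwise coprime, the bad sets `roots of g k` in `ℂ` and in `Q̄_p` (the multisets
`(g k).aroots ℂ`, `(g k).aroots (PadicAlgCl p)`) are pairwise disjoint at each place, so if every
mechanism-with-margin (all complex conjugates `r`-far from the complex roots of `g k`, all
`Q̄_p`-conjugates `r`-far from its `Q̄_p`-roots) carries the Vojta inequality in degree `≤ d` for the
target `ε`, then `VojtaIneq Set.univ d ε`. This is the shape delivered by a family of `2d+1`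
noncritical Belyi maps over `ℚ` on one curve with pairwise disjoint exceptional `x`-sets
("protection by poles"). [cite: MochizukiGenEll2010, Thm 2.1 proof p.12] -/
theorem vojtaIneq_univ_of_coprime (p : ℕ) [Fact p.Prime] (d : ℕ) {ε : ℝ} {κ : Type*} [Fintype κ]
    (g : κ → Polynomial ℚ) (hcop : Pairwise fun i j => IsCoprime (g i) (g j))
    (hcard : 2 * d < Fintype.card κ)
    (hV : ∀ k (r : ℝ), 0 < r → VojtaIneq {P : NFPoint |
        (∀ σ : P.F →+* ℂ, ∀ a ∈ (g k).aroots ℂ, r < ‖σ P.x - a‖) ∧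
        (∀ σ : P.F →+* PadicAlgCl p, ∀ a ∈ (g k).aroots (PadicAlgCl p), r < ‖σ P.x - a‖)} d ε) :
    VojtaIneq Set.univ d ε := by
  classical
  refine vojtaIneq_univ_of_pairwiseDisjoint p d (fun k => ((g k).aroots ℂ).toFinset)
    (fun k => ((g k).aroots (PadicAlgCl p)).toFinset)
    (fun i j hij => disjoint_aroots_toFinset_of_isCoprime (hcop hij))
    (fun i j hij => disjoint_aroots_toFinset_of_isCoprime (hcop hij)) hcard ?_
  intro k r hr
  have hset : {P : NFPoint |
        (∀ σ : P.F →+* ℂ, ∀ a ∈ ((g k).aroots ℂ).toFinset, r < ‖σ P.x - a‖) ∧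
        (∀ σ : P.F →+* PadicAlgCl p, ∀ a ∈ ((g k).aroots (PadicAlgCl p)).toFinset,
          r < ‖σ P.x - a‖)} =
      {P : NFPoint |
        (∀ σ : P.F →+* ℂ, ∀ a ∈ (g k).aroots ℂ, r < ‖σ P.x - a‖) ∧
        (∀ σ : P.F →+* PadicAlgCl p, ∀ a ∈ (g k).aroots (PadicAlgCl p), r < ‖σ P.x - a‖)} := by
    ext P
    simp only [Set.mem_setOf_eq, Multiset.mem_toFinset]
  rw [hset]
  exact hV k r hr

end Literature.NumberTheory.DiophantineGeometry.GenEll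

end
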